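import Literature.Analysis.FluidPDE.TorusVorticityMomentBalance
import HarnessLib

/-!
# Gibbon's vorticity-moment inequality for REAL exponents `q ≥ 2` (Gibbon 2010, App. A)

Analysis/FluidPDE proof file (theorems only; no definitions, no named facts). The tree's
`IsClassicalNSSolutionOn.deriv_integral_torusVorticitySqAt_pow_le` (`TorusVorticityMomentBalance`)
is Gibbon's unforced moment inequality `J̇ₘ ≤ 2m ∫ |ω|^{2(m−1)} ω·(ω·∇u)`, `Jₘ = ∫_{T^d}|ω|^{2m}`,
for NATURAL `m`; Gibbon 2010 states his moments for every real `m ≥ 1` (§1, "for `m ≥ 1`",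
`Ωₘ = (L⁻³∫|ω|^{2m})^{1/2m} + ϖ₀`; App. A, proof of Prop. 1). This file proves the real-exponent
form: along a classical solution of the UNFORCED Navier–Stokes/Euler system (`ν ≥ 0`) on
`T^d × [a, b]`, for every real `q ≥ 2` and every `t ∈ [a, b]`, every one-sided derivative value
`R` of `s ↦ Z_q(s) := ∫ (|ω(s, x)|²)^{q/2} dx` within `[a, b]` at `t` satisfies

`R ≤ q ∫ (|ω(t)|²)^{q/2 − 1} σ(t)`,  `σ = torusStretchingDensity` (`= ω·Sω` on `T³`).

Proof (the standard regularisation of the weight at `ω = 0`, where `s ↦ s^{q/2}` is not smooth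
for non-integer `q/2`): for `ε > 0` the weight `Φ_ε(s) = (s + ε)^{q/2}` is `C^∞` on `(−ε, ∞)`
with `Φ_ε' ≥ 0`, `Φ_ε'' ≥ 0` (`q ≥ 2`), so the tree's weighted balance
(`TorusWeightedVorticityBalance`, sign form `deriv_integral_comp_torusVorticitySqAt_le`) gives
`d/ds ∫Φ_ε(|ω|²) ≤ q ∫ (|ω|² + ε)^{q/2−1} σ` on `[a, b]`; the right side is within `δ` of
`G(s) = q∫(|ω|²)^{q/2−1}σ` uniformly on `[a, b] × T^d` for small `ε` (uniform continuity of
`y ↦ y^{q/2−1}` on a compact interval containing the values), and `G` is continuous in `s` (tube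
lemma over the compact torus); the mean value inequality on a short window around `t`, the limit
`ε → 0` at the two endpoints, and the slope characterisation of `R` give `R ≤ G(t) + 3δ` for every
`δ > 0`.

* `IsClassicalNSSolutionOn.deriv_integral_torusVorticitySqAt_rpow_le_of_two_le` — the theorem.

A priori differential inequality along smooth solutions only; nothing here is a regularity
criterion.

## References

* J. D. Gibbon, *Regularity and singularity in solutions of the three-dimensional Navier–Stokes
  equations*, Proc. R. Soc. A 466 (2010) 2587–2604, §1 (moments for real `m ≥ 1`) and
  Appendix A (proof of Prop. 1: the `Jₘ` balance, Laplacian term nonpositive). [Gibbon2010]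
* A. J. Majda, A. L. Bertozzi, *Vorticity and Incompressible Flow*, CUP 2002, §1.4
  (1.31)–(1.32). [MajdaBertozziCUP2002]
-/

noncomputable section

open Set MeasureTheory Filter Topology
open scoped ContDiff InnerProductSpace RealInnerProductSpace

namespace Literature.Analysis.FluidPDE

open Literature.Analysis.FunctionSpaces

variable {d : Type*} [Fintype d] [DecidableEq d]

namespace VorticityRealMoment

/-! ### Joint smoothness of `W`, `|ω|²`, `σ` along a jointly smooth velocity -/

/-- `(s, y) ↦ Wᵢⱼ(u(s))(y)` is jointly smooth on `[a, b] × T^d`. [folklore] -/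
private theorem isSmoothSpaceTimeOn_W {a b : ℝ}
    {u : ℝ → UnitAddTorus d → EuclideanSpace ℝ d} (hu : Torus.IsSmoothSpaceTimeOn (Icc a b) u)
    (hab : a < b) (i j : d) :
    Torus.IsSmoothSpaceTimeOn (Icc a b) (fun s y => torusVorticityTensor (u s) i j y) :=
  ((hu.partialDeriv (uniqueDiffOn_Icc hab) i).apply j).sub
    ((hu.partialDeriv (uniqueDiffOn_Icc hab) j).apply i)

/-- `(s, y) ↦ |ω(u(s))(y)|²` is jointly smooth on `[a, b] × T^d`. [folklore] -/
private theorem isSmoothSpaceTimeOn_Q {a b : ℝ}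
    {u : ℝ → UnitAddTorus d → EuclideanSpace ℝ d} (hu : Torus.IsSmoothSpaceTimeOn (Icc a b) u)
    (hab : a < b) :
    Torus.IsSmoothSpaceTimeOn (Icc a b) (fun s y => torusVorticitySqAt (u s) y) := by
  have h : ∀ i j, Torus.IsSmoothSpaceTimeOn (Icc a b)
      (fun s y => torusVorticityTensor (u s) i j y * torusVorticityTensor (u s) i j y) :=
    fun i j => (isSmoothSpaceTimeOn_W hu hab i j).mul (isSmoothSpaceTimeOn_W hu hab i j)
  have hs := Torus.IsSmoothSpaceTimeOn.sum (s := Finset.univ) fun i (_ : i ∈ Finset.univ) =>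
    Torus.IsSmoothSpaceTimeOn.sum (s := Finset.univ) fun j (_ : j ∈ Finset.univ) => h i j
  have hfun : (fun s y => torusVorticitySqAt (u s) y) = fun s y => (2⁻¹ : ℝ) •
      ∑ i, ∑ j, torusVorticityTensor (u s) i j y * torusVorticityTensor (u s) i j y := by
    funext s y
    simp only [torusVorticitySqAt, torusVorticityTensor, smul_eq_mul]
    congr 1
    exact Finset.sum_congr rfl fun i _ => Finset.sum_congr rfl fun j _ => by ring
  rw [hfun]
  exact hs.const_smul (2⁻¹ : ℝ)

/-- `(s, y) ↦ σ(u(s))(y)` is jointly smooth on `[a, b] × T^d`. [folklore] -/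
private theorem isSmoothSpaceTimeOn_σ {a b : ℝ}
    {u : ℝ → UnitAddTorus d → EuclideanSpace ℝ d} (hu : Torus.IsSmoothSpaceTimeOn (Icc a b) u)
    (hab : a < b) :
    Torus.IsSmoothSpaceTimeOn (Icc a b) (fun s y => torusStretchingDensity (u s) y) := by
  have hP : ∀ i k, Torus.IsSmoothSpaceTimeOn (Icc a b)
      (fun s y => Torus.partialDeriv i (u s) y k) :=
    fun i k => (hu.partialDeriv (uniqueDiffOn_Icc hab) i).apply k
  have h : ∀ i j k, Torus.IsSmoothSpaceTimeOn (Icc a b) (fun s y => torusVorticityTensor (u s) i j y *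
      (Torus.partialDeriv i (u s) y k * Torus.partialDeriv k (u s) y j)) :=
    fun i j k => (isSmoothSpaceTimeOn_W hu hab i j).mul ((hP i k).mul (hP k j))
  have hs := Torus.IsSmoothSpaceTimeOn.sum (s := Finset.univ) fun i (_ : i ∈ Finset.univ) =>
    Torus.IsSmoothSpaceTimeOn.sum (s := Finset.univ) fun j (_ : j ∈ Finset.univ) =>
      Torus.IsSmoothSpaceTimeOn.sum (s := Finset.univ) fun k (_ : k ∈ Finset.univ) => h i j k
  have hfun : (fun s y => torusStretchingDensity (u s) y) = fun s y => -∑ i, ∑ j, ∑ k,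
      torusVorticityTensor (u s) i j y *
        (Torus.partialDeriv i (u s) y k * Torus.partialDeriv k (u s) y j) := by
    funext s y
    simp only [torusStretchingDensity, Finset.mul_sum]
  rw [hfun]
  exact hs.neg

/-! ### Small analytic lemmas -/

/-- In the UNFORCED case the forcing term of the weighted balance vanishes. [folklore] -/
private theorem sum_W_mul_curl_zero (v : UnitAddTorus d → EuclideanSpace ℝ d)
    (t : ℝ) (x : UnitAddTorus d) :
    ∑ i, ∑ j, torusVorticityTensor v i j x *
      (Torus.partialDeriv i ((0 : ℝ → UnitAddTorus d → EuclideanSpace ℝ d) t) x j -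
        Torus.partialDeriv j ((0 : ℝ → UnitAddTorus d → EuclideanSpace ℝ d) t) x i) = 0 := by
  have h0 : ∀ i, Torus.partialDeriv i (0 : UnitAddTorus d → EuclideanSpace ℝ d) x = 0 := by
    intro i
    simp [Torus.partialDeriv, Torus.lineDeriv]
  simp [h0]

omit [DecidableEq d] in
/-- `|∫f − ∫g| ≤ c` on the torus (probability space) when `|f − g| ≤ c` pointwise. [folklore] -/
private theorem abs_integral_sub_le {f g : UnitAddTorus d → ℝ} (hf : Integrable f) (hg : Integrable g)
    {c : ℝ} (h : ∀ x, |f x - g x| ≤ c) : |(∫ x, f x) - ∫ x, g x| ≤ c := by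
  rw [← integral_sub hf hg]
  have h1 := norm_integral_le_of_norm_le_const (μ := (volume : Measure (UnitAddTorus d)))
    (f := fun x => f x - g x) (C := c) (ae_of_all _ fun x => by
      rw [Real.norm_eq_abs]; exact h x)
  simpa [Real.norm_eq_abs] using h1

omit [DecidableEq d] in
/-- Continuous functions on the (compact) torus are integrable. [folklore] -/
private theorem integrable_of_continuous {g : UnitAddTorus d → ℝ} (hg : Continuous g) :
    Integrable g := by
  have := hg.continuousOn.integrableOn_compact (μ := volume) isCompact_univ
  simpa using this

/-- Uniform smallness of `(y + ε)^γ − y^γ` on `[0, M]` for small `ε > 0` (`γ ≥ 0`; uniform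
continuity of `y ↦ y^γ` on the compact interval `[0, M + 1]`). [folklore] -/
private theorem exists_forall_abs_add_rpow_sub_rpow_lt {γ : ℝ} (hγ : 0 ≤ γ) (M : ℝ) {δ : ℝ}
    (hδ : 0 < δ) :
    ∃ ε₀ > 0, ∀ ε, 0 < ε → ε < ε₀ → ∀ y, 0 ≤ y → y ≤ M → |(y + ε) ^ γ - y ^ γ| < δ := by
  have huc : UniformContinuousOn (fun x : ℝ => x ^ γ) (Icc 0 (M + 1)) :=
    isCompact_Icc.uniformContinuousOn_of_continuous (Real.continuous_rpow_const hγ).continuousOn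
  obtain ⟨η, hη, hηuc⟩ := Metric.uniformContinuousOn_iff.mp huc δ hδ
  refine ⟨min η 1, lt_min hη one_pos, fun ε hε hεlt y hy0 hyM => ?_⟩
  have hεη : ε < η := lt_of_lt_of_le hεlt (min_le_left _ _)
  have hε1 : ε < 1 := lt_of_lt_of_le hεlt (min_le_right _ _)
  have h1 : y + ε ∈ Icc 0 (M + 1) := ⟨by linarith, by linarith⟩
  have h2 : y ∈ Icc 0 (M + 1) := ⟨hy0, by linarith⟩
  have h3 : dist (y + ε) y < η := by
    rw [Real.dist_eq, show y + ε - y = ε by ring, abs_of_pos hε]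
    exact hεη
  have := hηuc (y + ε) h1 y h2 h3
  rwa [Real.dist_eq] at this

/-! ### The regularised weight `Φ_ε(y) = (y + ε)^{q/2}` -/

/-- One step of the regularised balance: for `ε > 0`, `q ≥ 2`, along an unforced classical
solution (`ν ≥ 0`), `s ↦ ∫ (|ω(s)|² + ε)^{q/2}` is differentiable within `[a, b]` at every
`r ∈ [a, b]` with derivative `≤ q ∫ (|ω(r)|² + ε)^{q/2 − 1} σ(r)`. [folklore] -/
private theorem regularised_step {a b ν : ℝ} {u : ℝ → UnitAddTorus d → EuclideanSpace ℝ d}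
    {p : ℝ → UnitAddTorus d → ℝ} (h : Torus.IsClassicalNSSolutionOn (Icc a b) ν 0 u p)
    (hν : 0 ≤ ν) (hab : a < b) {q : ℝ} (hq : 2 ≤ q) {ε : ℝ} (hε : 0 < ε) {r : ℝ}
    (hr : r ∈ Icc a b) :
    ∃ D : ℝ, HasDerivWithinAt (fun s => ∫ x, (torusVorticitySqAt (u s) x + ε) ^ (q / 2)) D
        (Icc a b) r ∧
      D ≤ q * ∫ x, (torusVorticitySqAt (u r) x + ε) ^ (q / 2 - 1) *
        torusStretchingDensity (u r) x := by
  set Φ : ℝ → ℝ := fun y => (y + ε) ^ (q / 2) with hΦdef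
  have hp1 : 1 ≤ q / 2 := by linarith
  have hUo : IsOpen (Ioi (-ε)) := isOpen_Ioi
  have hΦcd : ContDiffOn ℝ ∞ Φ (Ioi (-ε)) := by
    refine (contDiffOn_id.add contDiffOn_const).rpow_const_of_ne fun y hy => ?_
    have : -ε < y := hy
    simp only [id_eq]
    linarith
  have hmaps : ∀ s ∈ Icc a b, ∀ x, torusVorticitySqAt (u s) x ∈ Ioi (-ε) := fun s _ x => by
    have := torusVorticitySqAt_nonneg (u s) x
    show -ε < torusVorticitySqAt (u s) x
    linarith
  have hd1 : ∀ y, deriv Φ y = q / 2 * (y + ε) ^ (q / 2 - 1) := by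
    intro y
    have := (((hasDerivAt_id' y).add_const ε).rpow_const (p := q / 2) (Or.inr hp1)).deriv
    rw [this]
    ring
  have hd1' : deriv Φ = fun y => q / 2 * (y + ε) ^ (q / 2 - 1) := funext hd1
  have hd2 : ∀ y, -ε < y →
      deriv (deriv Φ) y = q / 2 * (1 * (q / 2 - 1) * (y + ε) ^ (q / 2 - 1 - 1)) := by
    intro y hy
    rw [hd1']
    have hne : y + ε ≠ 0 := by
      intro h0
      linarith
    exact ((((hasDerivAt_id' y).add_const ε).rpow_const (p := q / 2 - 1) (Or.inl hne)).const_mul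
      (q / 2)).deriv
  obtain hD := h.hasDerivWithinAt_integral_comp_torusVorticitySqAt hab hUo hΦcd hmaps hr
  have hΦ1 : ∀ x, 0 ≤ deriv Φ (torusVorticitySqAt (u r) x) := by
    intro x
    rw [hd1]
    have h0 : 0 ≤ torusVorticitySqAt (u r) x + ε := by
      have := torusVorticitySqAt_nonneg (u r) x
      linarith
    exact mul_nonneg (by linarith) (Real.rpow_nonneg h0 _)
  have hΦ2 : ∀ x, 0 ≤ deriv (deriv Φ) (torusVorticitySqAt (u r) x) := by
    intro x
    have hy : -ε < torusVorticitySqAt (u r) x := hmaps r hr x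
    rw [hd2 _ hy]
    have h0 : 0 < torusVorticitySqAt (u r) x + ε := by linarith
    have : 0 ≤ (torusVorticitySqAt (u r) x + ε) ^ (q / 2 - 1 - 1) := (Real.rpow_pos_of_pos h0 _).le
    have hq1 : 0 ≤ q / 2 - 1 := by linarith
    have hq0 : 0 ≤ q / 2 := by linarith
    rw [one_mul]
    exact mul_nonneg hq0 (mul_nonneg hq1 this)
  have hle := h.deriv_integral_comp_torusVorticitySqAt_le hν hab hUo hΦcd hmaps hr hΦ1 hΦ2 hD
  refine ⟨_, hD, hle.trans (le_of_eq ?_)⟩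
  have e1 : (∫ x, q / 2 * (torusVorticitySqAt (u r) x + ε) ^ (q / 2 - 1) *
      torusStretchingDensity (u r) x) = q / 2 * ∫ x, (torusVorticitySqAt (u r) x + ε) ^ (q / 2 - 1) *
      torusStretchingDensity (u r) x := by
    rw [← integral_const_mul]
    exact integral_congr_ae (ae_of_all _ fun x => by ring)
  simp only [hd1, sum_W_mul_curl_zero, mul_zero, integral_zero, add_zero]
  rw [e1]
  ring

end VorticityRealMoment

open VorticityRealMoment in
/-- **Gibbon's unforced vorticity-moment inequality for every real exponent `q ≥ 2`**
(Gibbon 2010: moments `Ωₘ = (L⁻³∫|ω|^{2m})^{1/2m} + ϖ₀` "for `m ≥ 1`" real, §1; App. A, proof of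
Prop. 1 with `f = 0` and the nonpositive Laplacian term of step 1 dropped:
`J̇ₘ ≤ 2m ∫ |ω|^{2(m−1)} ω·(ω·∇u)`, `Jₘ = ∫|ω|^{2m}`, here `q = 2m`). Along a classical solution of
the UNFORCED Navier–Stokes/Euler system (`ν ≥ 0`) on `T^d × [a, b]` (`a < b`), for every real
`q ≥ 2` and `t ∈ [a, b]`, every one-sided derivative value `R` of
`s ↦ ∫ (torusVorticitySqAt (u s) x)^{q/2} = ∫|ω(s)|^q` within `[a, b]` at `t` satisfies
`R ≤ q ∫ (|ω(t)|²)^{q/2 − 1} σ(t)` (`σ = torusStretchingDensity (u t)`, `= ω·𝒟ω` on `T³`).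
The natural-number case is `deriv_integral_torusVorticitySqAt_pow_le`; the general case is proved
from the weighted balance with the regularised weights `(s + ε)^{q/2}`, `ε ↓ 0` (uniform
continuity of `y ↦ y^{q/2−1}` on a compact interval containing the values of `|ω|²`, the tube
lemma over the compact torus, and the mean value inequality). [cite: Gibbon2010, §1 (moments for real m ≥ 1) and Appendix A (proof of Prop. 1), opening identity and step 1] -/
theorem _root_.Literature.Analysis.FunctionSpaces.Torus.IsClassicalNSSolutionOn.deriv_integral_torusVorticitySqAt_rpow_le_of_two_le
    {a b ν : ℝ} {u : ℝ → UnitAddTorus d → EuclideanSpace ℝ d} {p : ℝ → UnitAddTorus d → ℝ}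
    (h : Torus.IsClassicalNSSolutionOn (Icc a b) ν 0 u p) (hν : 0 ≤ ν) (hab : a < b) {q : ℝ}
    (hq : 2 ≤ q) {t : ℝ} (ht : t ∈ Icc a b) {R : ℝ}
    (hR : HasDerivWithinAt (fun s => ∫ x, torusVorticitySqAt (u s) x ^ (q / 2)) R (Icc a b) t) :
    R ≤ q * ∫ x, torusVorticitySqAt (u t) x ^ (q / 2 - 1) * torusStretchingDensity (u t) x := by
  set S : Set ℝ := Icc a b with hSdef
  set β : ℝ := q / 2 - 1 with hβdef
  have hβ : 0 ≤ β := by rw [hβdef]; linarith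
  have hq0 : 0 < q := by linarith
  have hp0 : 0 ≤ q / 2 := by linarith
  have hu : Torus.IsSmoothSpaceTimeOn S u := h.smooth_velocity
  have hQst := isSmoothSpaceTimeOn_Q hu hab
  have hσst := isSmoothSpaceTimeOn_σ hu hab
  -- abbreviations
  set F : ℝ → ℝ := fun s => ∫ x, torusVorticitySqAt (u s) x ^ (q / 2) with hFdef
  obtain ⟨G, hG⟩ : ∃ G : ℝ → ℝ, ∀ s, G s = q * ∫ x, torusVorticitySqAt (u s) x ^ β *
      torusStretchingDensity (u s) x := ⟨_, fun _ => rfl⟩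
  rw [← hG t]
  -- slices are continuous
  have hQc : ∀ s ∈ S, Continuous (fun x => torusVorticitySqAt (u s) x) :=
    fun s hs => (hQst.isSmooth_slice hs).continuous
  have hσc : ∀ s ∈ S, Continuous (fun x => torusStretchingDensity (u s) x) :=
    fun s hs => (hσst.isSmooth_slice hs).continuous
  have hQ0 : ∀ s x, 0 ≤ torusVorticitySqAt (u s) x := fun s x => torusVorticitySqAt_nonneg _ _
  -- Step A: uniform bounds on `[a, b] × T^d`
  obtain ⟨M, hM⟩ : ∃ M : ℝ, ∀ s ∈ S, ∀ x, torusVorticitySqAt (u s) x ≤ M := by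
    obtain ⟨C, hC⟩ := hQst.exists_norm_le_of_isCompact isCompact_Icc subset_rfl
    exact ⟨C, fun s hs x => le_trans (le_abs_self _) (by simpa [Real.norm_eq_abs] using hC s hs x)⟩
  obtain ⟨K, hK⟩ : ∃ K : ℝ, ∀ s ∈ S, ∀ x, |torusStretchingDensity (u s) x| ≤ K := by
    obtain ⟨C, hC⟩ := hσst.exists_norm_le_of_isCompact isCompact_Icc subset_rfl
    exact ⟨C, fun s hs x => by simpa [Real.norm_eq_abs] using hC s hs x⟩
  have hK0 : 0 ≤ K := le_trans (abs_nonneg _) (hK t ht 0)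
  -- integrability of the integrands we meet
  have hintG : ∀ s ∈ S, Integrable (fun x => torusVorticitySqAt (u s) x ^ β *
      torusStretchingDensity (u s) x) := fun s hs =>
    integrable_of_continuous (((hQc s hs).rpow_const fun _ => Or.inr hβ).mul (hσc s hs))
  have hintGε : ∀ ε, 0 < ε → ∀ s ∈ S, Integrable (fun x => (torusVorticitySqAt (u s) x + ε) ^ β *
      torusStretchingDensity (u s) x) := fun ε _ s hs =>
    integrable_of_continuous ((((hQc s hs).add continuous_const).rpow_const
      fun _ => Or.inr hβ).mul (hσc s hs))
  have hintF : ∀ s ∈ S, Integrable (fun x => torusVorticitySqAt (u s) x ^ (q / 2)) := fun s hs =>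
    integrable_of_continuous ((hQc s hs).rpow_const fun _ => Or.inr hp0)
  have hintFε : ∀ ε, 0 < ε → ∀ s ∈ S,
      Integrable (fun x => (torusVorticitySqAt (u s) x + ε) ^ (q / 2)) := fun ε _ s hs =>
    integrable_of_continuous (((hQc s hs).add continuous_const).rpow_const fun _ => Or.inr hp0)
  -- Step B: `G` is continuous at `t` within `S` (tube lemma for `(|ω|²)^β σ`)
  have hGcont : ∀ δ > 0, ∀ᶠ s in 𝓝[S] t, G s ≤ G t + δ := by
    intro δ hδ
    have hw : ContinuousOn (Torus.stLift (fun s x => torusVorticitySqAt (u s) x ^ β *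
        torusStretchingDensity (u s) x)) (S ×ˢ univ) := by
      have e : Torus.stLift (fun s x => torusVorticitySqAt (u s) x ^ β *
          torusStretchingDensity (u s) x) =
          fun z => Torus.stLift (fun s x => torusVorticitySqAt (u s) x) z ^ β *
            Torus.stLift (fun s x => torusStretchingDensity (u s) x) z := by
        funext z; rfl
      rw [e]
      exact (hQst.continuousOn_stLift.rpow_const fun _ _ => Or.inr hβ).mul hσst.continuousOn_stLift
    have hev := Torus.eventually_norm_sub_lt_of_continuousOn hw ht (div_pos hδ hq0)
    filter_upwards [hev, self_mem_nhdsWithin] with s hs hsS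
    have h1 := abs_integral_sub_le (hintG s hsS) (hintG t ht) (c := δ / q) fun x => by
      have := hs x
      rw [Real.norm_eq_abs] at this
      exact this.le
    rw [hG s, hG t]
    have h2 := (abs_le.mp h1).2
    have h3 : q * (δ / q) = δ := by field_simp
    nlinarith [h2, hq0, h3]
  -- Step C: uniform regularisation estimates for small `ε`
  have hreg : ∀ δ > 0, ∃ ε₀ > 0, ∀ ε, 0 < ε → ε < ε₀ →
      (∀ s ∈ S, q * ∫ x, (torusVorticitySqAt (u s) x + ε) ^ β * torusStretchingDensity (u s) x ≤
          G s + δ) ∧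
      (∀ s ∈ S, |(∫ x, (torusVorticitySqAt (u s) x + ε) ^ (q / 2)) - F s| ≤ δ) := by
    intro δ hδ
    have hδ1 : 0 < δ / (q * (K + 1)) := div_pos hδ (mul_pos hq0 (by linarith))
    obtain ⟨ε₁, hε₁, h1⟩ := exists_forall_abs_add_rpow_sub_rpow_lt hβ M hδ1
    obtain ⟨ε₂, hε₂, h2⟩ := exists_forall_abs_add_rpow_sub_rpow_lt hp0 M hδ
    refine ⟨min ε₁ ε₂, lt_min hε₁ hε₂, fun ε hε hεlt => ⟨fun s hs => ?_, fun s hs => ?_⟩⟩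
    · have hε1' : ε < ε₁ := lt_of_lt_of_le hεlt (min_le_left _ _)
      have hpt : ∀ x, |(torusVorticitySqAt (u s) x + ε) ^ β * torusStretchingDensity (u s) x -
          torusVorticitySqAt (u s) x ^ β * torusStretchingDensity (u s) x| ≤
          δ / (q * (K + 1)) * K := by
        intro x
        rw [← sub_mul, abs_mul]
        exact mul_le_mul (h1 ε hε hε1' _ (hQ0 s x) (hM s hs x)).le (hK s hs x) (abs_nonneg _)
          hδ1.le
      have hI := abs_integral_sub_le (hintGε ε hε s hs) (hintG s hs) hpt
      rw [hG s]
      have hI2 := (abs_le.mp hI).2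
      have h3 : q * (δ / (q * (K + 1)) * K) ≤ δ := by
        rw [show q * (δ / (q * (K + 1)) * K) = δ * (K / (K + 1)) by field_simp]
        have : K / (K + 1) ≤ 1 := by
          rw [div_le_one (by linarith)]
          linarith
        nlinarith
      nlinarith [hI2, hq0]
    · have hε2' : ε < ε₂ := lt_of_lt_of_le hεlt (min_le_right _ _)
      exact abs_integral_sub_le (hintFε ε hε s hs) (hintF s hs) fun x =>
        (h2 ε hε hε2' _ (hQ0 s x) (hM s hs x)).le
  -- Step D: the target up to `2δ`
  have htarget : ∀ δ > 0, R ≤ G t + 2 * δ := by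
    intro δ hδ
    -- a window around `t` on which `G ≤ G t + δ`
    obtain ⟨η, hη, hwin⟩ : ∃ η > 0, ∀ s ∈ S, dist s t < η → G s ≤ G t + δ := by
      obtain ⟨η, hη, hsub⟩ := Metric.mem_nhdsWithin_iff.mp (hGcont δ hδ)
      exact ⟨η, hη, fun s hs hst => hsub ⟨hst, hs⟩⟩
    -- key: the integrated inequality for `F` on the window
    have hkey : ∀ x ∈ S, ∀ y ∈ S, dist x t < η → dist y t < η → x ≤ y →
        F y - F x ≤ (G t + 2 * δ) * (y - x) := by
      intro x hx y hy hxt hyt hxy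
      refine le_of_forall_pos_le_add fun δ' hδ' => ?_
      obtain ⟨ε₀, hε₀, hε⟩ := hreg (min δ (δ' / 2)) (lt_min hδ (half_pos hδ'))
      obtain ⟨hGε, hFε⟩ := hε (ε₀ / 2) (half_pos hε₀) (half_lt_self hε₀)
      set ε : ℝ := ε₀ / 2 with hεdef
      have hεpos : 0 < ε := half_pos hε₀
      set Fε : ℝ → ℝ := fun s => ∫ z, (torusVorticitySqAt (u s) z + ε) ^ (q / 2) with hFεdef
      have hIS : Icc x y ⊆ S := fun r hr => ⟨le_trans hx.1 hr.1, le_trans hr.2 hy.2⟩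
      have hstep : ∀ r ∈ S, ∃ D : ℝ, HasDerivWithinAt Fε D S r ∧
          D ≤ q * ∫ z, (torusVorticitySqAt (u r) z + ε) ^ β * torusStretchingDensity (u r) z :=
        fun r hr => regularised_step h hν hab hq hεpos hr
      have hcont : ContinuousOn Fε (Icc x y) := by
        intro r hr
        obtain ⟨D, hD, -⟩ := hstep r (hIS hr)
        exact hD.continuousWithinAt.mono hIS
      have hdiff : DifferentiableOn ℝ Fε (interior (Icc x y)) := by
        rw [interior_Icc]
        intro r hr
        have hrS : r ∈ S := hIS (Ioo_subset_Icc_self hr)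
        obtain ⟨D, hD, -⟩ := hstep r hrS
        have hSr : S ∈ 𝓝 r := Icc_mem_nhds (lt_of_le_of_lt hx.1 hr.1) (lt_of_lt_of_le hr.2 hy.2)
        exact (hD.hasDerivAt hSr).differentiableAt.differentiableWithinAt
      have hbound : ∀ r ∈ interior (Icc x y), deriv Fε r ≤ G t + 2 * δ := by
        rw [interior_Icc]
        intro r hr
        have hrS : r ∈ S := hIS (Ioo_subset_Icc_self hr)
        obtain ⟨D, hD, hDle⟩ := hstep r hrS
        have hSr : S ∈ 𝓝 r := Icc_mem_nhds (lt_of_le_of_lt hx.1 hr.1) (lt_of_lt_of_le hr.2 hy.2)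
        rw [(hD.hasDerivAt hSr).deriv]
        have h1 := hGε r hrS
        have hrt : dist r t < η := by
          rw [Real.dist_eq] at hxt hyt ⊢
          rw [abs_lt] at hxt hyt ⊢
          constructor <;> linarith [hr.1, hr.2]
        have h2 := hwin r hrS hrt
        linarith [min_le_left δ (δ' / 2)]
      have hmv := (convex_Icc x y).image_sub_le_mul_sub_of_deriv_le hcont hdiff hbound x
        (left_mem_Icc.2 hxy) y (right_mem_Icc.2 hxy) hxy
      have hFx := abs_le.mp (hFε x hx)
      have hFy := abs_le.mp (hFε y hy)
      have hm : min δ (δ' / 2) ≤ δ' / 2 := min_le_right _ _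
      linarith [hFx.1, hFx.2, hFy.1, hFy.2]
    -- slopes of `F` at `t` are `≤ G t + 2δ` on the window
    have hslope : ∀ s ∈ S, dist s t < η → s ≠ t → slope F t s ≤ G t + 2 * δ := by
      intro s hs hst hne
      rw [slope_def_field]
      have htt : dist t t < η := by simp [hη]
      rcases lt_or_gt_of_ne hne with hlt | hgt
      · have hk := hkey s hs t ht hst htt hlt.le
        rw [div_le_iff_of_neg (sub_neg.2 hlt)]
        linarith
      · have hk := hkey t ht s hs htt hst hgt.le
        rw [div_le_iff₀ (sub_pos.2 hgt)]
        linarith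
    have htend : Tendsto (slope F t) (𝓝[S \ {t}] t) (𝓝 R) := hasDerivWithinAt_iff_tendsto_slope.mp hR
    haveI hne : (𝓝[S \ {t}] t).NeBot := by
      rcases lt_or_eq_of_le ht.2 with htb | htb
      · have hsub : Ioo t b ⊆ S \ {t} := fun r hr =>
          ⟨⟨le_trans ht.1 hr.1.le, hr.2.le⟩, fun hrt => by
            have : r = t := hrt
            linarith [hr.1]⟩
        have hle := nhdsWithin_mono t hsub
        rw [nhdsWithin_Ioo_eq_nhdsGT htb] at hle
        exact neBot_of_le hle
      · have hat : a < t := by rw [htb]; exact hab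
        have hsub : Ioo a t ⊆ S \ {t} := fun r hr =>
          ⟨⟨hr.1.le, (lt_of_lt_of_eq hr.2 htb).le⟩, fun hrt => by
            have : r = t := hrt
            linarith [hr.2]⟩
        have hle := nhdsWithin_mono t hsub
        rw [nhdsWithin_Ioo_eq_nhdsLT hat] at hle
        exact neBot_of_le hle
    have hev : ∀ᶠ s in 𝓝[S \ {t}] t, slope F t s ≤ G t + 2 * δ := by
      have h1 : ∀ᶠ s in 𝓝[S \ {t}] t, s ∈ S \ {t} := self_mem_nhdsWithin
      have h2 : ∀ᶠ s in 𝓝[S \ {t}] t, dist s t < η :=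
        mem_nhdsWithin_of_mem_nhds (Metric.ball_mem_nhds t hη)
      filter_upwards [h1, h2] with s hs hs2
      exact hslope s hs.1 hs2 hs.2
    exact le_of_tendsto htend hev
  -- Step E: `δ → 0`
  refine le_of_forall_pos_le_add fun δ hδ => ?_
  have := htarget (δ / 2) (half_pos hδ)
  linarith

end Literature.Analysis.FluidPDE
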